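import Summits.CriticalPhenomena.PercolationContinuityZ3.Theorems.PercGamblersRuinVerticalGamblersRuinDiffusivityKernel
import Summits.CriticalPhenomena.PercolationContinuityZ3.Theorems.PercGamblersRuinVerticalGamblersRuinAntiConcentration
import Summits.CriticalPhenomena.PercolationContinuityZ3.Theorems.PercGamblersRuinVerticalGamblersRuinStubHeightSymmetry
import Summits.CriticalPhenomena.PercolationContinuityZ3.Theorems.PercGamblersRuinVerticalGamblersRuinStubFourthMoment

/-!
# Route `PercGamblersRuin`, crux `VerticalGamblersRuin` (stmt-CriticalPhenomena-10642): the crux from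
# positive annealed diffusivity (line `registered`, rev 9, lead c3)

`stub_VGRofDiffusivity : DIFF → VerticalGamblersRuin`, DIFF = the open stub `stub_diffusivity` of the skeleton
("positive annealed diffusivity of the SRW on the would-be critical infinite cluster": if `θ(p_c) > 0` there
are `σ > 0`, `T₀` with `σ·T ≤ ∫_{0↔∞} deg_ω(0)·(𝒫_ω^T h²)(0) dP_{p_c}` for all `T ≥ T₀`, `h x = x₀`).  It composes the
landed `stub_VGRofAC : AC → VGR` (p163776) with the PALEY–ZYGMUND step `AC_of_DIFF : DIFF → AC`: for the positive
linear functional `Λ_T F := ∫_{0↔∞} deg·(𝒫^T F)(0) dP`, `Y = h(X_T)`, `E = {|Y| ≥ n}`: Cauchy–Schwarz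
`Λ(Y²1_E)² ≤ Λ(Y⁴)Λ(1_E)` (discriminant of `s ↦ Λ(1_E(sY²-1)²) ≥ 0`), `Λ(Y²1_E) ≥ Λ(Y²) - n²Λ(1) ≥ σT/2` at
`T := max T₀ ⌈12n²/σ⌉`, `Λ(Y⁴) ≤ 1782T²` (`stub_fourthMoment`, p165991), `Λ(1_{Y≥n}) = Λ(1_{Y≤-n})`
(`stub_heightSymmetry`, p164684), `deg ≤ 6` ⇒ `∫ (𝒫^T 1_{Y≥n})(0) ≥ σ²/(48·1782)`, and `T ≤ (T₀+1+12/σ)n²`.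
What remains open along this line is exactly DIFF (Kipnis–Varadhan / De Masi–Ferrari–Goldstein–Wick give `σ² ≥ 0`
θ-blind; `σ² > 0` = positive effective conductivity of the would-be critical cluster).
References: Paley–Zygmund (1932); Kipnis–Varadhan, CMP 104 (1986); De Masi–Ferrari–Goldstein–Wick, JSP 55 (1989) §4.
-/

noncomputable section

namespace Summit.CriticalPhenomena.PercolationContinuityZ3.Theorems.VerticalGamblersRuin

open MeasureTheory Filter Topology
open Literature.Probability.Percolation Literature.Probability.LatticeModels
open scoped Classical

open Diffusivity in
/-- **`AC_of_DIFF` — annealed anti-concentration at one deterministic time from positive annealed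
diffusivity (Paley–Zygmund).** -/
theorem AC_of_DIFF :
    (0 < theta (zdGraph 3) (0 : Site 3) (criticalProbI 3) →
    ∃ σ : ℝ, 0 < σ ∧ ∃ T₀ : ℕ, ∀ T ≥ T₀,
      ∀ Pop : BondConfig (Site 3) → (Site 3 → ℝ) → Site 3 → ℝ,
        (∀ ω (g : Site 3 → ℝ) (x : Site 3), Pop ω g x =
          (∑ y ∈ ((zdGraph 3).neighborFinset x).filter (fun y => s(x, y) ∈ ω), g y) /
            ((((zdGraph 3).neighborFinset x).filter (fun y => s(x, y) ∈ ω)).card : ℝ)) →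
        σ * (T : ℝ) ≤ ∫ ω in percolatesAt (0 : Site 3),
            ((((zdGraph 3).neighborFinset (0 : Site 3)).filter
                (fun y => s((0 : Site 3), y) ∈ ω)).card : ℝ) *
              ((Pop ω)^[T] (fun x => ((x 0 : ℤ) : ℝ) ^ 2)) 0
            ∂(bondPercolation (zdGraph 3) (criticalProbI 3))) →
    (0 < theta (zdGraph 3) (0 : Site 3) (criticalProbI 3) →
    ∃ c : ℝ, 0 < c ∧ ∀ C₀ : ℝ, 0 < C₀ → ∃ K : ℕ, 0 < K ∧ ∃ N : ℕ, ∀ n ≥ N, ∃ T : ℕ,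
      C₀ * (T : ℝ) ≤ c * (((K * n : ℕ) : ℝ) ^ 2) ∧
      ∀ Pop : BondConfig (Site 3) → (Site 3 → ℝ) → Site 3 → ℝ,
        (∀ ω (g : Site 3 → ℝ) (x : Site 3), Pop ω g x =
          (∑ y ∈ ((zdGraph 3).neighborFinset x).filter (fun y => s(x, y) ∈ ω), g y) /
            ((((zdGraph 3).neighborFinset x).filter (fun y => s(x, y) ∈ ω)).card : ℝ)) →
        2 * c ≤ ∫ ω in percolatesAt (0 : Site 3),
            ((Pop ω)^[T] (fun x => if (n : ℤ) ≤ x 0 then (1 : ℝ) else 0)) 0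
            ∂(bondPercolation (zdGraph 3) (criticalProbI 3))) := by

  intro hDiff hθ
  obtain ⟨σ, hσ, T₀, hD⟩ := hDiff hθ
  refine ⟨σ ^ 2 / (96 * 1782), by positivity, ?_⟩
  intro C₀ hC₀
  set c : ℝ := σ ^ 2 / (96 * 1782) with hcdef
  have hc : 0 < c := by positivity
  set κ : ℝ := (T₀ : ℝ) + 1 + 12 / σ with hκdef
  have h12σ : 0 ≤ 12 / σ := div_nonneg (by norm_num) hσ.le
  have hκ : 0 < κ := by positivity
  refine ⟨⌈C₀ * κ / c⌉₊ + 1, Nat.succ_pos _, 1, ?_⟩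
  intro n hn
  have hn1 : (1 : ℝ) ≤ n := by exact_mod_cast hn
  have hn2 : (1 : ℝ) ≤ (n : ℝ) ^ 2 := by nlinarith
  set T : ℕ := max T₀ ⌈12 * (n : ℝ) ^ 2 / σ⌉₊ with hTdef
  have hT₀ : T₀ ≤ T := le_max_left _ _
  have hceilT' : ⌈12 * (n : ℝ) ^ 2 / σ⌉₊ ≤ T := le_max_right _ _
  have hceilT : ((⌈12 * (n : ℝ) ^ 2 / σ⌉₊ : ℕ) : ℝ) ≤ (T : ℝ) := Nat.cast_le.mpr hceilT'
  have hT12 : 12 * (n : ℝ) ^ 2 / σ ≤ T := (Nat.le_ceil _).trans hceilT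
  have hσT : 12 * (n : ℝ) ^ 2 ≤ σ * T := by
    have := (div_le_iff₀ hσ).1 hT12
    linarith
  have hTpos : (0 : ℝ) < T := by
    have : (0 : ℝ) < 12 * (n : ℝ) ^ 2 := by positivity
    nlinarith
  have hT1 : 1 ≤ T := by exact_mod_cast hTpos
  have hTle : (T : ℝ) ≤ κ * (n : ℝ) ^ 2 := by
    have h1 : ((⌈12 * (n : ℝ) ^ 2 / σ⌉₊ : ℕ) : ℝ) ≤ 12 * (n : ℝ) ^ 2 / σ + 1 :=
      (Nat.ceil_lt_add_one (by positivity)).le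
    have h2 : (T : ℝ) ≤ max (T₀ : ℝ) (12 * (n : ℝ) ^ 2 / σ + 1) := by
      rw [hTdef]; push_cast; exact max_le_max le_rfl h1
    have h3 : max (T₀ : ℝ) (12 * (n : ℝ) ^ 2 / σ + 1) ≤ κ * (n : ℝ) ^ 2 := by
      refine max_le ?_ ?_
      · have : (T₀ : ℝ) ≤ (T₀ : ℝ) * (n : ℝ) ^ 2 := le_mul_of_one_le_right (Nat.cast_nonneg _) hn2
        have hrest : 0 ≤ (1 + 12 / σ) * (n : ℝ) ^ 2 := by positivity
        calc (T₀ : ℝ) ≤ (T₀ : ℝ) * (n : ℝ) ^ 2 + (1 + 12 / σ) * (n : ℝ) ^ 2 := by linarith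
          _ = κ * (n : ℝ) ^ 2 := by rw [hκdef]; ring
      · have e : 12 * (n : ℝ) ^ 2 / σ = (12 / σ) * (n : ℝ) ^ 2 := by ring
        rw [e]
        have hT₀n : 0 ≤ (T₀ : ℝ) * (n : ℝ) ^ 2 := by positivity
        calc 12 / σ * (n : ℝ) ^ 2 + 1 ≤ 12 / σ * (n : ℝ) ^ 2 + (n : ℝ) ^ 2 + (T₀ : ℝ) * (n : ℝ) ^ 2 := by
              linarith
          _ = κ * (n : ℝ) ^ 2 := by rw [hκdef]; ring
    exact h2.trans h3
  refine ⟨T, ?_, ?_⟩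
  · -- `C₀ T ≤ c (K n)²`
    set K : ℕ := ⌈C₀ * κ / c⌉₊ + 1 with hKdef
    have hK1 : (1 : ℝ) ≤ K := by
      rw [hKdef]; push_cast; linarith [Nat.cast_nonneg (α := ℝ) (⌈C₀ * κ / c⌉₊)]
    have hKge : C₀ * κ / c ≤ K := by
      rw [hKdef]; push_cast; linarith [Nat.le_ceil (C₀ * κ / c)]
    have hKsq : C₀ * κ / c ≤ (K : ℝ) ^ 2 := hKge.trans (by nlinarith)
    have hK2 : C₀ * κ ≤ c * (K : ℝ) ^ 2 := by
      rw [div_le_iff₀ hc] at hKsq; linarith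
    calc C₀ * (T : ℝ) ≤ C₀ * (κ * (n : ℝ) ^ 2) := mul_le_mul_of_nonneg_left hTle hC₀.le
      _ = (C₀ * κ) * (n : ℝ) ^ 2 := by ring
      _ ≤ (c * (K : ℝ) ^ 2) * (n : ℝ) ^ 2 := mul_le_mul_of_nonneg_right hK2 (by positivity)
      _ = c * (((K * n : ℕ) : ℝ) ^ 2) := by push_cast; ring
  · -- anti-concentration at time `T`
    intro Pop hPop
    set P := bondPercolation (zdGraph 3) (criticalProbI 3) with hPdef
    set deg : BondConfig (Site 3) → ℝ := fun ω =>
      ((((zdGraph 3).neighborFinset (0 : Site 3)).filter (fun y => s((0 : Site 3), y) ∈ ω)).card : ℝ)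
      with hdegdef
    have hdeg0 : ∀ ω, 0 ≤ deg ω := fun ω => Nat.cast_nonneg _
    have hdeg6 : ∀ ω, deg ω ≤ 6 := fun ω => DeterministicTime.deg_le_six ω 0
    have hdeg_meas : Measurable deg := StubStationarity.measurable_card_filter_zero
    set Y2 : Site 3 → ℝ := fun x => ((x 0 : ℤ) : ℝ) ^ 2 with hY2
    set Y4 : Site 3 → ℝ := fun x => ((x 0 : ℤ) : ℝ) ^ 4 with hY4
    set IE : Site 3 → ℝ := fun x => if (n : ℤ) ≤ |x 0| then (1 : ℝ) else 0 with hIE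
    set Iup : Site 3 → ℝ := fun x => if (n : ℤ) ≤ x 0 then (1 : ℝ) else 0 with hIup
    set Idn : Site 3 → ℝ := fun x => if x 0 ≤ -(n : ℤ) then (1 : ℝ) else 0 with hIdn
    set Y2E : Site 3 → ℝ := fun x => Y2 x * IE x with hY2E
    set Y4E : Site 3 → ℝ := fun x => Y4 x * IE x with hY4E
    have hlin_add : ∀ ω (F G : Site 3 → ℝ), ((Pop ω)^[T] fun y => F y + G y) 0 =
        ((Pop ω)^[T] F) 0 + ((Pop ω)^[T] G) 0 := fun ω F G => by
      rw [full_iterate_add (hPop ω) T]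
    have hlin_smul : ∀ ω (a : ℝ) (F : Site 3 → ℝ), ((Pop ω)^[T] fun y => a * F y) 0 =
        a * ((Pop ω)^[T] F) 0 := fun ω a F => by
      rw [full_iterate_smul (hPop ω) T]
    have hmono : ∀ ω (F G : Site 3 → ℝ), (∀ y, F y ≤ G y) →
        ((Pop ω)^[T] F) 0 ≤ ((Pop ω)^[T] G) 0 :=
      fun ω F G h => full_iterate_mono (hPop ω) T h 0
    have hIE01 : ∀ y, 0 ≤ IE y ∧ IE y ≤ 1 := fun y => by
      rw [hIE]; simp only; split_ifs <;> norm_num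
    have hIup01 : ∀ y, 0 ≤ Iup y ∧ Iup y ≤ 1 := fun y => by
      rw [hIup]; simp only; split_ifs <;> norm_num
    have hIdn01 : ∀ y, 0 ≤ Idn y ∧ Idn y ≤ 1 := fun y => by
      rw [hIdn]; simp only; split_ifs <;> norm_num
    have hY20 : ∀ y, 0 ≤ Y2 y := fun y => by rw [hY2]; positivity
    have hY40 : ∀ y, 0 ≤ Y4 y := fun y => by rw [hY4]; positivity
    have hball2 : ∀ y : Site 3, |y 0 - (0 : Site 3) 0| ≤ (T : ℤ) → Y2 y ≤ (T : ℝ) ^ 2 := by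
      intro y hy
      simp only [Pi.zero_apply, sub_zero] at hy
      have h : |((y 0 : ℤ) : ℝ)| ≤ T := by exact_mod_cast hy
      rw [hY2]; simp only
      rw [← sq_abs]
      exact pow_le_pow_left₀ (abs_nonneg _) h 2
    have hball4 : ∀ y : Site 3, |y 0 - (0 : Site 3) 0| ≤ (T : ℤ) → Y4 y ≤ (T : ℝ) ^ 4 := by
      intro y hy
      have h2 := hball2 y hy
      rw [hY4]; simp only
      have e : ((y 0 : ℤ) : ℝ) ^ 4 = (((y 0 : ℤ) : ℝ) ^ 2) ^ 2 := by ring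
      have e' : ((T : ℝ)) ^ 4 = ((T : ℝ) ^ 2) ^ 2 := by ring
      rw [e, e']
      have h2' : ((y 0 : ℤ) : ℝ) ^ 2 ≤ (T : ℝ) ^ 2 := by simpa [hY2] using h2
      exact pow_le_pow_left₀ (by positivity) h2' 2
    have bY2 : ∀ ω, 0 ≤ ((Pop ω)^[T] Y2) 0 ∧ ((Pop ω)^[T] Y2) 0 ≤ (T : ℝ) ^ 2 := fun ω =>
      full_iterate_mem_Icc_of_ball hPop ω T 0 (by positivity) hY20 hball2
    have bY4 : ∀ ω, 0 ≤ ((Pop ω)^[T] Y4) 0 ∧ ((Pop ω)^[T] Y4) 0 ≤ (T : ℝ) ^ 4 := fun ω =>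
      full_iterate_mem_Icc_of_ball hPop ω T 0 (by positivity) hY40 hball4
    have bY2E : ∀ ω, 0 ≤ ((Pop ω)^[T] Y2E) 0 ∧ ((Pop ω)^[T] Y2E) 0 ≤ (T : ℝ) ^ 2 := fun ω =>
      full_iterate_mem_Icc_of_ball hPop ω T 0 (by positivity)
        (fun y => mul_nonneg (hY20 y) (hIE01 y).1) (fun y hy =>
          calc Y2 y * IE y ≤ (T : ℝ) ^ 2 * 1 :=
                mul_le_mul (hball2 y hy) (hIE01 y).2 (hIE01 y).1 (by positivity)
            _ = (T : ℝ) ^ 2 := mul_one _)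
    have bY4E : ∀ ω, 0 ≤ ((Pop ω)^[T] Y4E) 0 ∧ ((Pop ω)^[T] Y4E) 0 ≤ (T : ℝ) ^ 4 := fun ω =>
      full_iterate_mem_Icc_of_ball hPop ω T 0 (by positivity)
        (fun y => mul_nonneg (hY40 y) (hIE01 y).1) (fun y hy =>
          calc Y4 y * IE y ≤ (T : ℝ) ^ 4 * 1 :=
                mul_le_mul (hball4 y hy) (hIE01 y).2 (hIE01 y).1 (by positivity)
            _ = (T : ℝ) ^ 4 := mul_one _)
    have b01 : ∀ (I : Site 3 → ℝ), (∀ y, 0 ≤ I y ∧ I y ≤ 1) → ∀ ω,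
        0 ≤ ((Pop ω)^[T] I) 0 ∧ ((Pop ω)^[T] I) 0 ≤ 1 := fun I hI ω =>
      DeterministicTime.full_iterate_mem_Icc (hPop ω) T hI 0
    have hmeas : ∀ F : Site 3 → ℝ, Measurable fun ω => ((Pop ω)^[T] F) 0 := fun F =>
      DeterministicTime.measurable_full_iterate (F := fun _ => F) (fun _ => measurable_const) hPop T 0
    have hint : ∀ (F : Site 3 → ℝ) (B : ℝ), (∀ ω, 0 ≤ ((Pop ω)^[T] F) 0 ∧ ((Pop ω)^[T] F) 0 ≤ B) →
        Integrable (fun ω => deg ω * ((Pop ω)^[T] F) 0) P := by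
      intro F B hb
      refine Integrable.of_bound (hdeg_meas.mul (hmeas F)).aestronglyMeasurable (6 * B)
        (Eventually.of_forall fun ω => ?_)
      rw [Real.norm_eq_abs, abs_of_nonneg (mul_nonneg (hdeg0 ω) (hb ω).1)]
      exact mul_le_mul (hdeg6 ω) (hb ω).2 (hb ω).1 (by norm_num)
    have iY2 := hint Y2 _ bY2
    have iY4 := hint Y4 _ bY4
    have iY2E := hint Y2E _ bY2E
    have iY4E := hint Y4E _ bY4E
    have iIE := hint IE 1 (b01 IE hIE01)
    have iIup := hint Iup 1 (b01 Iup hIup01)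
    have iIdn := hint Idn 1 (b01 Idn hIdn01)
    have i1 := hint (fun _ => (1 : ℝ)) 1 (b01 (fun _ => (1 : ℝ)) (fun _ => ⟨zero_le_one, le_rfl⟩))
    obtain ⟨L2, hL2⟩ : ∃ L : ℝ, L = ∫ ω in percolatesAt (0 : Site 3), deg ω * ((Pop ω)^[T] Y2) 0 ∂P := ⟨_, rfl⟩
    obtain ⟨L4, hL4⟩ : ∃ L : ℝ, L = ∫ ω in percolatesAt (0 : Site 3), deg ω * ((Pop ω)^[T] Y4) 0 ∂P := ⟨_, rfl⟩
    obtain ⟨L2E, hL2E⟩ : ∃ L : ℝ, L = ∫ ω in percolatesAt (0 : Site 3), deg ω * ((Pop ω)^[T] Y2E) 0 ∂P := ⟨_, rfl⟩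
    obtain ⟨L4E, hL4E⟩ : ∃ L : ℝ, L = ∫ ω in percolatesAt (0 : Site 3), deg ω * ((Pop ω)^[T] Y4E) 0 ∂P := ⟨_, rfl⟩
    obtain ⟨LE, hLE⟩ : ∃ L : ℝ, L = ∫ ω in percolatesAt (0 : Site 3), deg ω * ((Pop ω)^[T] IE) 0 ∂P := ⟨_, rfl⟩
    obtain ⟨Lup, hLup⟩ : ∃ L : ℝ, L = ∫ ω in percolatesAt (0 : Site 3), deg ω * ((Pop ω)^[T] Iup) 0 ∂P := ⟨_, rfl⟩
    obtain ⟨Ldn, hLdn⟩ : ∃ L : ℝ, L = ∫ ω in percolatesAt (0 : Site 3), deg ω * ((Pop ω)^[T] Idn) 0 ∂P := ⟨_, rfl⟩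
    obtain ⟨L1, hL1⟩ : ∃ L : ℝ, L = ∫ ω in percolatesAt (0 : Site 3), deg ω * ((Pop ω)^[T] (fun _ => (1 : ℝ))) 0 ∂P := ⟨_, rfl⟩
    obtain ⟨J, hJ⟩ : ∃ L : ℝ, L = ∫ ω in percolatesAt (0 : Site 3), ((Pop ω)^[T] Iup) 0 ∂P := ⟨_, rfl⟩
    have e4 : L4 ≤ 1782 * (T : ℝ) ^ 2 := by rw [hL4]; exact stub_fourthMoment T hT1 Pop hPop
    have eS : Lup = Ldn := by rw [hLup, hLdn]; exact stub_heightSymmetry T (n : ℤ) Pop hPop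
    have eD : σ * (T : ℝ) ≤ L2 := by rw [hL2]; exact hD T hT₀ Pop hPop
    have e1 : L1 ≤ 6 := by
      have hb := b01 (fun _ => (1 : ℝ)) (fun _ => ⟨zero_le_one, le_rfl⟩)
      rw [hL1]
      calc ∫ ω in percolatesAt (0 : Site 3), deg ω * ((Pop ω)^[T] (fun _ => (1 : ℝ))) 0 ∂P
          ≤ ∫ ω in percolatesAt (0 : Site 3), (6 : ℝ) ∂P :=
            setIntegral_mono i1.integrableOn (integrable_const _).integrableOn (fun ω =>
              (mul_le_mul (hdeg6 ω) (hb ω).2 (hb ω).1 (by norm_num)).trans (by norm_num))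
        _ = P.real (percolatesAt (0 : Site 3)) * 6 := by
            rw [setIntegral_const, smul_eq_mul]
        _ ≤ 1 * 6 := mul_le_mul_of_nonneg_right measureReal_le_one (by norm_num)
        _ = 6 := by norm_num
    have e3 : L2 - (n : ℝ) ^ 2 * L1 ≤ L2E := by
      have hn2' : (0 : ℝ) ≤ (n : ℝ) ^ 2 := by positivity
      have hpt : ∀ ω, deg ω * ((Pop ω)^[T] Y2) 0 -
          (n : ℝ) ^ 2 * (deg ω * ((Pop ω)^[T] (fun _ => (1 : ℝ))) 0) ≤
          deg ω * ((Pop ω)^[T] Y2E) 0 := by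
        intro ω
        have h1 : ((Pop ω)^[T] Y2) 0 ≤ ((Pop ω)^[T] (fun y => Y2E y + (n : ℝ) ^ 2 * (1 : ℝ))) 0 := by
          refine hmono ω _ _ (fun y => ?_)
          rw [hY2E, hIE]; simp only
          by_cases hy : (n : ℤ) ≤ |y 0|
          · rw [if_pos hy, mul_one, mul_one]
            linarith
          · rw [if_neg hy, mul_zero, mul_one, zero_add]
            have hy' : |((y 0 : ℤ) : ℝ)| ≤ n := by exact_mod_cast (not_le.1 hy).le
            rw [hY2]; simp only
            rw [← sq_abs]
            exact pow_le_pow_left₀ (abs_nonneg _) hy' 2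
        rw [hlin_add, hlin_smul] at h1
        have h2 := mul_le_mul_of_nonneg_left h1 (hdeg0 ω)
        have h3 : deg ω * (((Pop ω)^[T] Y2E) 0 + (n : ℝ) ^ 2 * ((Pop ω)^[T] (fun _ => (1 : ℝ))) 0) =
            deg ω * ((Pop ω)^[T] Y2E) 0 + (n : ℝ) ^ 2 * (deg ω * ((Pop ω)^[T] (fun _ => (1 : ℝ))) 0) := by
          ring
        linarith
      have iL : Integrable (fun ω => deg ω * ((Pop ω)^[T] Y2) 0 -
          (n : ℝ) ^ 2 * (deg ω * ((Pop ω)^[T] (fun _ => (1 : ℝ))) 0)) P :=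
        iY2.sub (i1.const_mul ((n : ℝ) ^ 2))
      have h := setIntegral_mono (μ := P) (s := percolatesAt (0 : Site 3)) iL.integrableOn
        iY2E.integrableOn (fun ω => hpt ω)
      rw [integral_sub iY2.integrableOn (i1.const_mul ((n : ℝ) ^ 2)).integrableOn,
        integral_const_mul] at h
      rw [hL2, hL1, hL2E]
      exact h
    have e4' : L4E ≤ L4 := by
      rw [hL4E, hL4]
      exact setIntegral_mono iY4E.integrableOn iY4.integrableOn (fun ω =>
        mul_le_mul_of_nonneg_left (hmono ω _ _ fun y => by
          rw [hY4E]; simp only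
          calc Y4 y * IE y ≤ Y4 y * 1 := mul_le_mul_of_nonneg_left (hIE01 y).2 (hY40 y)
            _ = Y4 y := mul_one _) (hdeg0 ω))
    have hq : ∀ s : ℝ, 0 ≤ s ^ 2 * L4E - 2 * s * L2E + LE := by
      intro s
      have hpt : ∀ ω, 0 ≤ deg ω * ((Pop ω)^[T] (fun y => IE y * (s * Y2 y - 1) ^ 2)) 0 := fun ω =>
        mul_nonneg (hdeg0 ω) (full_iterate_nonneg (hPop ω) T (fun y =>
          mul_nonneg (hIE01 y).1 (sq_nonneg _)) 0)
      have hexp : ∀ ω, deg ω * ((Pop ω)^[T] (fun y => IE y * (s * Y2 y - 1) ^ 2)) 0 =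
          (s ^ 2 * (deg ω * ((Pop ω)^[T] Y4E) 0) - 2 * s * (deg ω * ((Pop ω)^[T] Y2E) 0)) +
            deg ω * ((Pop ω)^[T] IE) 0 := by
        intro ω
        have hfun : (fun y => IE y * (s * Y2 y - 1) ^ 2) =
            fun y => (s ^ 2 * Y4E y + (-(2 * s)) * Y2E y) + IE y := by
          funext y
          have hIy : IE y = 1 ∨ IE y = 0 := by
            rw [hIE]; simp only
            by_cases hy : (n : ℤ) ≤ |y 0|
            · left; rw [if_pos hy]
            · right; rw [if_neg hy]
          have hY : Y4 y = Y2 y ^ 2 := by rw [hY4, hY2]; simp only; ring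
          rw [hY4E, hY2E]; simp only
          rw [hY]
          rcases hIy with h1 | h0
          · rw [h1]; ring
          · rw [h0]; ring
        rw [hfun, hlin_add, hlin_add, hlin_smul, hlin_smul]
        ring
      have h := setIntegral_nonneg (μ := P) (measurableSet_percolatesAt_holds (0 : Site 3))
        (fun ω _ => hpt ω)
      have iA : Integrable (fun ω => s ^ 2 * (deg ω * ((Pop ω)^[T] Y4E) 0) -
          2 * s * (deg ω * ((Pop ω)^[T] Y2E) 0)) P :=
        (iY4E.const_mul (s ^ 2)).sub (iY2E.const_mul (2 * s))
      have hfun2 : (fun ω => deg ω * ((Pop ω)^[T] (fun y => IE y * (s * Y2 y - 1) ^ 2)) 0) =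
          fun ω => (s ^ 2 * (deg ω * ((Pop ω)^[T] Y4E) 0) - 2 * s * (deg ω * ((Pop ω)^[T] Y2E) 0)) +
            deg ω * ((Pop ω)^[T] IE) 0 := funext hexp
      rw [hfun2, integral_add iA.integrableOn iIE.integrableOn,
        integral_sub (iY4E.const_mul (s ^ 2)).integrableOn (iY2E.const_mul (2 * s)).integrableOn,
        integral_const_mul, integral_const_mul] at h
      rw [hL4E, hL2E, hLE]
      linarith
    have hL4E0 : 0 ≤ L4E := by
      rw [hL4E]
      exact setIntegral_nonneg (measurableSet_percolatesAt_holds (0 : Site 3))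
        (fun ω _ => mul_nonneg (hdeg0 ω) (bY4E ω).1)
    have hLE0 : 0 ≤ LE := by
      rw [hLE]
      exact setIntegral_nonneg (measurableSet_percolatesAt_holds (0 : Site 3))
        (fun ω _ => mul_nonneg (hdeg0 ω) (b01 IE hIE01 ω).1)
    have e6a : LE ≤ Lup + Ldn := by
      rw [hLE, hLup, hLdn, ← integral_add iIup.integrableOn iIdn.integrableOn]
      refine setIntegral_mono iIE.integrableOn (iIup.add iIdn).integrableOn (fun ω => ?_)
      have h := hmono ω IE (fun y => Iup y + Idn y) (fun y => by
        rw [hIE, hIup, hIdn]; simp only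
        by_cases hy : (n : ℤ) ≤ |y 0|
        · rw [if_pos hy]
          rcases le_abs'.1 hy with h' | h'
          · have h'' : y 0 ≤ -(n : ℤ) := by linarith
            rw [if_pos h'']
            split_ifs <;> norm_num
          · rw [if_pos h']
            split_ifs <;> norm_num
        · rw [if_neg hy]
          split_ifs <;> norm_num)
      rw [hlin_add] at h
      have := mul_le_mul_of_nonneg_left h (hdeg0 ω)
      simpa only [mul_add] using this
    have e7 : Lup ≤ 6 * J := by
      rw [hLup, hJ, ← integral_const_mul]
      have iI : Integrable (fun ω => ((Pop ω)^[T] Iup) 0) P :=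
        StubStationarity.integrable_of_bounds (hmeas Iup) (b01 Iup hIup01) P
      exact setIntegral_mono iIup.integrableOn (iI.const_mul 6).integrableOn (fun ω =>
        mul_le_mul_of_nonneg_right (hdeg6 ω) (b01 Iup hIup01 ω).1)
    -- Cauchy–Schwarz: `L2E² ≤ L4E · LE`
    have ecs : L2E ^ 2 ≤ L4E * LE := by
      rcases eq_or_lt_of_le hL4E0 with hz | hpos
      · -- `L4E = 0`: `-2 s L2E + LE ≥ 0` for all `s` forces `L2E = 0`
        have hzero : L2E = 0 := by
          by_contra hne
          have h1 := hq ((LE + 1) / (2 * L2E))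
          rw [← hz] at h1
          have e : 2 * ((LE + 1) / (2 * L2E)) * L2E = LE + 1 := by field_simp
          linarith
        rw [hzero, ← hz]; norm_num
      · have h1 := hq (L2E / L4E)
        have e : (L2E / L4E) ^ 2 * L4E - 2 * (L2E / L4E) * L2E + LE = LE - L2E ^ 2 / L4E := by
          field_simp; ring
        rw [e] at h1
        have h2 : L2E ^ 2 / L4E ≤ LE := by linarith
        rwa [div_le_iff₀ hpos, mul_comm] at h2
    -- `σ T / 2 ≤ L2E`
    have hhalf : σ * T / 2 ≤ L2E := by
      have h1 : (n : ℝ) ^ 2 * L1 ≤ (n : ℝ) ^ 2 * 6 := mul_le_mul_of_nonneg_left e1 (by positivity)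
      linarith
    -- `LE ≥ σ²/(4·1782)`
    have e5 : σ ^ 2 / (4 * 1782) ≤ LE := by
      have hsq : (σ * T / 2) ^ 2 ≤ L2E ^ 2 := pow_le_pow_left₀ (by positivity) hhalf 2
      have hL4T : L4E ≤ 1782 * (T : ℝ) ^ 2 := e4'.trans e4
      have h1 : (σ * T / 2) ^ 2 ≤ 1782 * (T : ℝ) ^ 2 * LE :=
        hsq.trans (ecs.trans (mul_le_mul_of_nonneg_right hL4T hLE0))
      have hT2 : (0 : ℝ) < (T : ℝ) ^ 2 := by positivity
      have h2 : σ ^ 2 / 4 * (T : ℝ) ^ 2 ≤ 1782 * LE * (T : ℝ) ^ 2 := by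
        have e1' : (σ * T / 2) ^ 2 = σ ^ 2 / 4 * (T : ℝ) ^ 2 := by ring
        have e2' : 1782 * (T : ℝ) ^ 2 * LE = 1782 * LE * (T : ℝ) ^ 2 := by ring
        rw [← e1', ← e2']; exact h1
      have h3 : σ ^ 2 / 4 ≤ 1782 * LE := le_of_mul_le_mul_right h2 hT2
      rw [div_le_iff₀ (by positivity)]
      linarith
    -- symmetry and the unweighted integral
    have e6 : LE ≤ 2 * Lup := by linarith
    have hfin : 2 * c ≤ J := by
      rw [hcdef]
      have e : 2 * (σ ^ 2 / (96 * 1782)) = σ ^ 2 / (48 * 1782) := by ring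
      rw [e, div_le_iff₀ (by positivity)]
      rw [div_le_iff₀ (by positivity)] at e5
      linarith
    rw [hJ] at hfin
    exact hfin


/-- **stub `stub_VGRofDiffusivity` of line `registered` (rev 9; exact registered signature): the crux
`VerticalGamblersRuin` from positive annealed diffusivity of the SRW on the would-be critical infinite
cluster** — `stub_VGRofAC ∘ AC_of_DIFF`. -/
theorem stub_VGRofDiffusivity :
    (0 < theta (zdGraph 3) (0 : Site 3) (criticalProbI 3) →
    ∃ σ : ℝ, 0 < σ ∧ ∃ T₀ : ℕ, ∀ T ≥ T₀,
      ∀ Pop : BondConfig (Site 3) → (Site 3 → ℝ) → Site 3 → ℝ,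
        (∀ ω (g : Site 3 → ℝ) (x : Site 3), Pop ω g x =
          (∑ y ∈ ((zdGraph 3).neighborFinset x).filter (fun y => s(x, y) ∈ ω), g y) /
            ((((zdGraph 3).neighborFinset x).filter (fun y => s(x, y) ∈ ω)).card : ℝ)) →
        σ * (T : ℝ) ≤ ∫ ω in percolatesAt (0 : Site 3),
            ((((zdGraph 3).neighborFinset (0 : Site 3)).filter
                (fun y => s((0 : Site 3), y) ∈ ω)).card : ℝ) *
              ((Pop ω)^[T] (fun x => ((x 0 : ℤ) : ℝ) ^ 2)) 0
            ∂(bondPercolation (zdGraph 3) (criticalProbI 3))) →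
    Summit.CriticalPhenomena.PercolationContinuityZ3.Theses.PercGamblersRuin.VerticalGamblersRuin := by
  intro hDiff
  exact stub_VGRofAC (AC_of_DIFF hDiff)

end Summit.CriticalPhenomena.PercolationContinuityZ3.Theorems.VerticalGamblersRuin

end
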